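/-
Origin: expansion seat `planner-pub-hodgecm-mc-axioms-3-0`, handover #163 2026-08-18T19:08Z md5 f6cd87bbb3f9 (RETIRED TWIN → re-export of the row above; same batch mandatory; importers untouched) (`HOME/mc/pub-hodgecm-mc-axioms-3/vend/stage/HodgeCM/Vendored/Hermitian.lean`, md5 f6cd87bb, 34 lines);
landed by the packager successor (mc-unitary-1-g3, gen-8 kit) in gate run 32 REPLACES the earlier landed copy of `HodgeCM/Vendored/Hermitian.lean` (verbatim).
-/
-- RETIRED TWIN (P0 packet 3, mc-axioms-3, 2026-08-18). This file used to hold a vendored EXCERPT (lines 76–280) of the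
-- harness tree module `Literature/AlgebraicGeometry/ShimuraVarieties/UnitaryBallQuotientDatum.lean`; that module is now
-- vendored WHOLE and VERBATIM as `HodgeCM.Vendored.H21.AlgebraicGeometry.ShimuraVarieties.UnitaryBallQuotientDatum` (all 21
-- declarations of the excerpt byte-identical there — DIFF-CERT in HOME/mc/pub-hodgecm-mc-axioms-3/vend/). Kept here, unchanged:
-- the two PKG additions `conjRingHomK`, `embedding_conjRingHomK` (complex conjugation of an ABSTRACT CM number field).
import Literature.AlgebraicGeometry.ShimuraVarieties.UnitaryBallQuotientDatum

/-!
# Hermitian forms by a Gram matrix over a CM field (retired twin → re-export) + `conjRingHomK`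

Importers of `HodgeCM.Vendored.Hermitian` see exactly the declarations they saw before (now from the vendored tree
module) plus `conjRingHomK` / `embedding_conjRingHomK` below.
-/

noncomputable section

open Matrix NumberField Topology
open scoped ComplexOrder

namespace Literature.AlgebraicGeometry.ShimuraVarieties

/-- (Added in the vendored copy.) Complex conjugation of an abstract CM number field `K` as a ring
endomorphism: Mathlib's `IsCMField.complexConj K : K ≃ₐ[K⁺] K`. [folklore] -/
def conjRingHomK (K : Type*) [Field K] [NumberField K] [IsCMField K] : K →+* K :=
  (IsCMField.complexConj K).toRingEquiv.toRingHom

/-- (Added.) Every complex embedding intertwines `conjRingHomK` with complex conjugation. [folklore] -/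
theorem embedding_conjRingHomK (K : Type*) [Field K] [NumberField K] [IsCMField K]
    (τ : K →+* ℂ) (x : K) : τ (conjRingHomK K x) = starRingEnd ℂ (τ x) :=
  IsCMField.complexEmbedding_complexConj K τ x

end Literature.AlgebraicGeometry.ShimuraVarieties

end
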